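import Mathlib
import HarnessLib
import Summits.Ventures.LatticeQCDFlow.Scoring.IMHAcceptanceRecord
import Summits.Ventures.LatticeQCDFlow.Scoring.IMHAcceptanceRecordTilt
import Summits.Ventures.LatticeQCDFlow.Exactness.ApproxTrivializingSampler

/-!
# The acceptance record of the exact flow-MCMC chain, IV: the sojourn law at path level

HONEST FRAMING: exact (Metropolis-corrected) sampling algorithms for lattice gauge theory;
figures of merit are autocorrelation/cost numbers at stated couplings and volumes; no
continuum-physics claim.

Venture `LatticeQCDFlow` (cell pub-lqcd), topic `Scoring`; flow / samplers seat (GEN-39).  NEW WORK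
of the cell, not a published result; no definition is introduced; nothing is cited as a fact.
Printed counterpart NAMED ONLY: Douc–Robert (Ann. Statist. 39, 2011), Lemma 1 — along a
Metropolis–Hastings path the accepted states `𝔵_i` carry multiplicities `𝔫_i`, geometric with
parameter `p(𝔵_i)` given `𝔵_i`, and `Σ_t h(x_t) = Σ_i 𝔫_i h(𝔵_i)` (Rao–Blackwellisations:
Delmas–Jourdain 2009, Schuster–Klebanov 2020).  Built on I (`IMHAcceptanceRecord.lean`: `imhRecord`,
`acceptFlag`, THE RECORD LAW `integral_acceptFlag_mul`, `imhRecordPath`), III (`…Tilt.lean`),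
`ChainTimeAverage.lean` (`chain_tower`, `chain_marginal` over Mathlib's `Kernel.trajMeasure`) and
`Exactness.flowSampler_exact_doeblin`; the operator-level sticking terms `E_π[(1 − α)^t …]` of
`Exactness/IMHWeightBlindTau.lean` &c. concern `(kop K)^[t]` — here the law is ON THE PATH SPACE.
Notation of I–III: model `q`, weight `w > 0`, `α(x) = (imhAcceptMass q w x).toReal`,
`A = acceptFlag`, `Z_n = (X_n, A_n)` the record chain, `P̂_{μ̂₀}` its path law from ANY initial
record law `μ̂₀` (spelled out), `P̂ = imhRecordPath q w π` the stationary one (`π K = π`),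
`π̂ = imhRecord q w ∘ₘ π`; "`k` rejections after `a`" is the event `A_{a+1} = … = A_{a+k} = reject`.
* §2 **`rejectRun_tower`** (any start): `E[F(Z_{≤a}) Π_{j<k}(1 − A_{a+1+j})] = E[F(Z_{≤a})
  (1 − α(X_a))^k]` for bounded measurable history functionals `F` — given the past, the next `k`
  moves are all rejections with probability EXACTLY `(1 − α(X_a))^k`; §1 is the case `k = 1`.
* §3 **`rejectRun_prob_le_of_floor`** (any start, `α ≥ m`, `H` a measurable set of histories
  `Z_{≤a}`): `P̂_{μ̂₀}(H, k rejections after a) ≤ (1 − m)^k P̂_{μ̂₀}(H)`.  In equilibrium: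
  **`acceptedRun_prob_eq`** `P̂(Z_a ∈ S × {accept}, k rejections after a) = ∫_S α (1 − α)^k dπ`,
  THE GEOMETRIC LAW OF THE MULTIPLICITIES (marks `T ⊆ Ω × Bool`: `markedRun_prob_eq`), and
  **`hasSum_acceptedRun_prob`** `Σ_k P̂(Z_a ∈ S × {accept}, k rejections after a) = π(S)`: since
  `Σ_k 1{≥ k rejections follow}` is the multiplicity of the accepted state, THE
  MULTIPLICITY-WEIGHTED ACCEPTED ROWS REPRODUCE `π` EXACTLY — the path form of III's `1/α` weights.
* §4 `flowSampler_sojourn_law`: the exact flow sampler on `SU(n)^E` under the hypotheses of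
  `flowSampler_exact_doeblin` (uniform Lüscher defect `δ`, every volume), `m = e^{−2δ}`.
NOT CLAIMED: any number of ours; the Markov property of `(𝔵_i, 𝔫_i)` or a CLT for
`Σ_i 𝔫_i h(𝔵_i)`; variance comparisons; cost; anything deciding between samplers.
-/

noncomputable section
namespace Summit.Ventures.LatticeQCDFlow.Scoring
open MeasureTheory ProbabilityTheory Filter Finset Preorder Summit.Ventures.LatticeQCDFlow.Exactness
open scoped ENNReal Topology

variable {Ω : Type*} [MeasurableSpace Ω]

/-- `1_{f ∈ S ∧ Q} = 1_S(f ·) · 1_Q`. -/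
theorem RejectRun.indicator_and {X Y : Type*} (S : Set Y) (f : X → Y) (Q : X → Prop) (x : X) :
    {y | f y ∈ S ∧ Q y}.indicator (1 : X → ℝ) x = S.indicator 1 (f x) * {y | Q y}.indicator 1 x :=
  by by_cases hP : f x ∈ S <;> by_cases hQ : Q x <;> simp [hP, hQ]

/-- "`k` rejections after `a`" is a measurable event of the record path. -/
theorem measurable_rejectRun (a k : ℕ) :
    Measurable fun x : ℕ → Ω × Bool => ∀ j < k, (x (a + 1 + j)).2 = false :=
  Measurable.forall fun j => measurable_const.imp (measurableSet_setOf.1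
    ((measurable_snd.comp (measurable_pi_apply (X := fun _ : ℕ => Ω × Bool) (a + 1 + j)))
      (measurableSet_singleton false)))

omit [MeasurableSpace Ω] in
/-- `|1 − A| ≤ 1`. -/
theorem abs_one_sub_acceptFlag_le (z : Ω × Bool) : |1 - acceptFlag z| ≤ 1 := by
  unfold acceptFlag; split_ifs <;> norm_num

omit [MeasurableSpace Ω] in
/-- **The rejection-run indicator is a product of flags**:
`Π_{j<k} (1 − A(Z_{a+1+j})) = 1{A_{a+1} = … = A_{a+k} = reject}`. -/
theorem prod_one_sub_acceptFlag (x : ℕ → Ω × Bool) (a k : ℕ) :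
    ∏ j ∈ range k, (1 - acceptFlag (x (a + 1 + j)))
      = {y : ℕ → Ω × Bool | ∀ j < k, (y (a + 1 + j)).2 = false}.indicator 1 x := by
  classical
  simp only [Set.indicator_apply, Set.mem_setOf_eq, Pi.one_apply]
  split_ifs with h
  · exact prod_eq_one fun j hj => by simp [acceptFlag, h j (mem_range.1 hj)]
  · push Not at h
    obtain ⟨j, hj, hne⟩ := h
    have ht : (x (a + 1 + j)).2 = true := by simpa using hne
    exact prod_eq_zero (mem_range.2 hj) (by simp [acceptFlag, ht])

variable {q : Measure Ω} [IsProbabilityMeasure q] {w : Ω → ℝ} {π : Measure Ω}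

/-- `α ≤ 1`. -/
theorem toReal_imhAcceptMass_le_one (x : Ω) : (imhAcceptMass q w x).toReal ≤ 1 :=
  (le_abs_self _).trans (abs_toReal_imhAcceptMass_le x)

/-- `|(1 − α)^k| ≤ 1`. -/
theorem abs_pow_one_sub_toReal_imhAcceptMass_le (x : Ω) (k : ℕ) :
    |(1 - (imhAcceptMass q w x).toReal) ^ k| ≤ 1 := by
  rw [abs_pow, abs_of_nonneg (sub_nonneg.2 (toReal_imhAcceptMass_le_one (q := q) (w := w) x))]
  exact pow_le_one₀ (sub_nonneg.2 (toReal_imhAcceptMass_le_one x))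
    (sub_le_self _ ENNReal.toReal_nonneg)

/-! ### §1 One rejected move: the state is kept and charged `1 − α` -/

/-- **`K̂[(1 − A) · (g ∘ fst)] = ((1 − α) · g) ∘ fst`**: integrating a function of the new state
against the REJECT part of one record step from `z` gives `(1 − α(z.1)) g(z.1)`. -/
theorem kop_imhRecord_rejectFlag_mul (hw : Measurable w) (hw0 : ∀ x, 0 < w x) {g : Ω → ℝ}
    (hg : Measurable g) {C : ℝ} (hC : ∀ x, |g x| ≤ C) :
    kop (Kernel.prodMkRight Bool (imhRecord q w)) (fun z => (1 - acceptFlag z) * g z.1)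
      = fun z => (1 - (imhAcceptMass q w z.1).toReal) * g z.1 := by
  have hGm : Measurable fun z : Ω × Bool => (1 - acceptFlag z) * g z.1 :=
    (measurable_const.sub measurable_acceptFlag).mul (hg.comp measurable_fst)
  have hGb : ∀ z : Ω × Bool, |(1 - acceptFlag z) * g z.1| ≤ 1 * C := fun z => by
    rw [abs_mul]
    exact mul_le_mul (abs_one_sub_acceptFlag_le z) (hC z.1) (abs_nonneg _) zero_le_one
  funext z
  have hIa : Integrable (imhAccept w z.1) q :=
    integrable_of_bounded q (measurable_imhAccept_right hw z.1) (C := 1) fun y => by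
      rw [abs_of_nonneg (imhAccept_nonneg hw0 _ _)]; exact imhAccept_le_one w _ _
  unfold kop
  rw [Kernel.prodMkRight_apply, integral_imhRecord hw hw0 hGm hGb z.1]
  calc _ = ∫ y, (1 - imhAccept w z.1 y) * g z.1 ∂q :=
        integral_congr_ae (ae_of_all _ fun y => by simp [acceptFlag])
    _ = _ := by
        rw [integral_mul_const, integral_sub (integrable_const _) hIa, integral_const,
          probReal_univ, one_smul, toReal_imhAcceptMass hw hw0]

/-! ### §2 The sojourn tower (any start) -/

section Path
variable [Fact (Measurable w)]

/-- **THE SOJOURN TOWER** (any initial record law `μ̂₀`, bounded measurable history functional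
`F`): `E[F(Z_{≤a}) · Π_{j<k}(1 − A_{a+1+j})] = E[F(Z_{≤a}) · (1 − α(X_a))^k]` — conditionally on
the past, `k` consecutive rejections have probability exactly `(1 − α(X_a))^k`. -/
theorem rejectRun_tower (hw0 : ∀ x, 0 < w x) (μ₀ : Measure (Ω × Bool)) [IsProbabilityMeasure μ₀] :
    let P := Kernel.trajMeasure (X := fun _ : ℕ => Ω × Bool) μ₀
      (fun t : ℕ => (Kernel.prodMkRight Bool (imhRecord q w)).comap
        (fun y : (i : ↥(Finset.Iic t)) → Ω × Bool => y ⟨t, Finset.mem_Iic.2 le_rfl⟩)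
        (measurable_pi_apply _))
    ∀ (k a : ℕ) {F : ((i : ↥(Finset.Iic a)) → Ω × Bool) → ℝ}, Measurable F → ∀ {CF : ℝ},
      (∀ h, |F h| ≤ CF) →
      ∫ x, F (frestrictLe a x) * ∏ j ∈ range k, (1 - acceptFlag (x (a + 1 + j))) ∂P
        = ∫ x, F (frestrictLe a x) * (1 - (imhAcceptMass q w (x a).1).toReal) ^ k ∂P := by
  intro P k
  induction k with
  | zero => intro a F hF CF hCF; simp only [prod_range_zero, pow_zero]
  | succ k ih =>
    intro a F hF CF hCF
    have hw : Measurable w := Fact.out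
    have hpm : Measurable fun x : Ω => (1 - (imhAcceptMass q w x).toReal) ^ k :=
      (measurable_const.sub (measurable_toReal_imhAcceptMass hw)).pow_const k
    have ih' := ih (a + 1) -- the first rejection moved into the history
      (F := fun h : (i : ↥(Finset.Iic (a + 1))) → Ω × Bool =>
        F (frestrictLe₂ (π := fun _ : ℕ => Ω × Bool) (Nat.le_succ a) h) *
          (1 - acceptFlag (h ⟨a + 1, Finset.mem_Iic.2 le_rfl⟩)))
      ((hF.comp (measurable_frestrictLe₂ (X := fun _ : ℕ => Ω × Bool) (Nat.le_succ a))).mul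
        (measurable_const.sub (measurable_acceptFlag.comp (measurable_pi_apply _))))
      (CF := |CF| * 1) fun h => by
        rw [abs_mul]
        exact mul_le_mul ((hCF _).trans (le_abs_self _)) (abs_one_sub_acceptFlag_le _)
          (abs_nonneg _) (abs_nonneg _)
    have key := chain_tower (Kernel.prodMkRight Bool (imhRecord q w)) μ₀ a hF hCF
      (g := fun z : Ω × Bool => (1 - acceptFlag z) * (1 - (imhAcceptMass q w z.1).toReal) ^ k)
      ((measurable_const.sub measurable_acceptFlag).mul (hpm.comp measurable_fst))
      (Cg := 1 * 1) fun z => by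
        rw [abs_mul]
        exact mul_le_mul (abs_one_sub_acceptFlag_le z)
          (abs_pow_one_sub_toReal_imhAcceptMass_le z.1 k) (abs_nonneg _) zero_le_one
    rw [kop_imhRecord_rejectFlag_mul hw hw0 hpm (abs_pow_one_sub_toReal_imhAcceptMass_le · k)]
      at key
    beta_reduce at key
    simp only [show ∀ j : ℕ, a + 1 + 1 + j = a + 1 + (j + 1) from fun j => by omega] at ih'
    calc _ = ∫ x : ℕ → Ω × Bool, F (frestrictLe₂ (π := fun _ : ℕ => Ω × Bool) (Nat.le_succ a)
                (frestrictLe (a + 1) x)) *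
              (1 - acceptFlag (frestrictLe (a + 1) x ⟨a + 1, Finset.mem_Iic.2 le_rfl⟩)) *
            ∏ j ∈ range k, (1 - acceptFlag (x (a + 1 + (j + 1)))) ∂P := by
          refine integral_congr_ae (ae_of_all _ fun x => ?_)
          dsimp only
          show _ = F (frestrictLe a x) * (1 - acceptFlag (x (a + 1))) * _
          rw [prod_range_succ', Nat.add_zero]
          ring
      _ = _ := ih'
      _ = ∫ x : ℕ → Ω × Bool, F (frestrictLe a x) * ((1 - acceptFlag (x (a + 1))) *
            (1 - (imhAcceptMass q w (x (a + 1)).1).toReal) ^ k) ∂P :=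
          integral_congr_ae (ae_of_all _ fun x => mul_assoc _ _ _)
      _ = _ := key
      _ = _ := integral_congr_ae (ae_of_all _ fun x => by ring)

/-! ### §3 Rejection runs from any start; sojourns and multiplicities in equilibrium -/

/-- **UNIFORM GEOMETRIC TAIL OF THE REJECTION RUNS, from any start.**  Under an acceptance floor
`α ≥ m`, for EVERY initial record law `μ̂₀`, every measurable set `H` of histories `Z_{≤a}` and
every `k`: `P̂_{μ̂₀}(Z_{≤a} ∈ H, k rejections after a) ≤ (1 − m)^k · P̂_{μ̂₀}(Z_{≤a} ∈ H)`. -/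
theorem rejectRun_prob_le_of_floor (hw0 : ∀ x, 0 < w x) (μ₀ : Measure (Ω × Bool))
    [IsProbabilityMeasure μ₀] {m : ℝ} (hfl : ∀ x, m ≤ (imhAcceptMass q w x).toReal) (a k : ℕ)
    {H : Set ((i : ↥(Finset.Iic a)) → Ω × Bool)} (hH : MeasurableSet H) :
    let P := Kernel.trajMeasure (X := fun _ : ℕ => Ω × Bool) μ₀
      (fun t : ℕ => (Kernel.prodMkRight Bool (imhRecord q w)).comap
        (fun y : (i : ↥(Finset.Iic t)) → Ω × Bool => y ⟨t, Finset.mem_Iic.2 le_rfl⟩)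
        (measurable_pi_apply _))
    P.real {x | frestrictLe a x ∈ H ∧ ∀ j < k, (x (a + 1 + j)).2 = false}
      ≤ (1 - m) ^ k * P.real (frestrictLe a ⁻¹' H) := by
  intro P
  have hα1 : ∀ x, (imhAcceptMass q w x).toReal ≤ 1 := toReal_imhAcceptMass_le_one
  have hE : MeasurableSet
      {x : ℕ → Ω × Bool | frestrictLe a x ∈ H ∧ ∀ j < k, (x (a + 1 + j)).2 = false} :=
    measurableSet_setOf.2 ((measurableSet_setOf.1 (measurable_frestrictLe a hH)).and
      (measurable_rejectRun a k))
  have hI0 : ∀ h, 0 ≤ H.indicator (1 : ((i : ↥(Finset.Iic a)) → Ω × Bool) → ℝ) h := fun h =>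
    Set.indicator_nonneg (fun _ _ => zero_le_one) _
  have hI1 : ∀ h, |H.indicator (1 : ((i : ↥(Finset.Iic a)) → Ω × Bool) → ℝ) h| ≤ 1 := fun h => by
    by_cases hh : h ∈ H <;> simp [hh]
  calc _ = ∫ x, H.indicator 1 (frestrictLe a x) * ∏ j ∈ range k, (1 - acceptFlag (x (a + 1 + j)))
          ∂P := by
        rw [← integral_indicator_one hE]
        refine integral_congr_ae (ae_of_all _ fun x => ?_)
        dsimp only
        rw [prod_one_sub_acceptFlag]
        exact RejectRun.indicator_and H (frestrictLe a) _ x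
    _ = ∫ x, H.indicator 1 (frestrictLe a x) * (1 - (imhAcceptMass q w (x a).1).toReal) ^ k ∂P :=
        rejectRun_tower (q := q) hw0 μ₀ k a
          (F := H.indicator (1 : ((i : ↥(Finset.Iic a)) → Ω × Bool) → ℝ))
          (measurable_one.indicator hH) hI1
    _ ≤ ∫ x, H.indicator 1 (frestrictLe a x) * (1 - m) ^ k ∂P := by
        refine integral_mono_of_nonneg
          (ae_of_all _ fun x => mul_nonneg (hI0 _) (pow_nonneg (sub_nonneg.2 (hα1 _)) _))
          ((integrable_of_bounded _ ((measurable_one.indicator hH).comp (measurable_frestrictLe a))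
            fun x => hI1 _).mul_const _) (ae_of_all _ fun x => ?_)
        exact mul_le_mul_of_nonneg_left
          (pow_le_pow_left₀ (sub_nonneg.2 (hα1 _)) (sub_le_sub_left (hfl _) 1) k) (hI0 _)
    _ = _ := by
        rw [integral_mul_const, mul_comm, ← integral_indicator_one (measurable_frestrictLe a hH)]
        rfl

variable [IsProbabilityMeasure π]

/-- **Sojourn moments in equilibrium**: for bounded measurable `Φ` on `Ω × Bool`,
`E_P̂[Φ(Z_a) · Π_{j<k}(1 − A_{a+1+j})] = ∫ Φ · ((1 − α)^k ∘ fst) dπ̂`. -/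
theorem integral_mul_rejectRun (hw0 : ∀ x, 0 < w x) (hinv : Kernel.Invariant (indepMH q w) π)
    {Φ : Ω × Bool → ℝ} (hΦ : Measurable Φ) {C : ℝ} (hC : ∀ z, |Φ z| ≤ C) (a k : ℕ) :
    ∫ x, Φ (x a) * ∏ j ∈ range k, (1 - acceptFlag (x (a + 1 + j))) ∂(imhRecordPath q w π)
      = ∫ z, Φ z * (1 - (imhAcceptMass q w z.1).toReal) ^ k ∂(imhRecord q w ∘ₘ π) := by
  have hw : Measurable w := Fact.out
  have h := rejectRun_tower (q := q) hw0 (imhRecord q w ∘ₘ π) k a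
    (F := fun h : (i : ↥(Finset.Iic a)) → Ω × Bool => Φ (h ⟨a, Finset.mem_Iic.2 le_rfl⟩))
    (hΦ.comp (measurable_pi_apply _)) fun h => hC _
  simp only [frestrictLe_apply] at h
  rw [imhRecordPath, h]
  exact chain_marginal (imhRecord_invariant hw hinv) a
    (f := fun z : Ω × Bool => Φ z * (1 - (imhAcceptMass q w z.1).toReal) ^ k)
    (hΦ.mul (((measurable_const.sub (measurable_toReal_imhAcceptMass hw)).pow_const k).comp
      measurable_fst)) (C := C * 1) fun z => by
      rw [abs_mul]
      exact mul_le_mul (hC z) (abs_pow_one_sub_toReal_imhAcceptMass_le _ k) (abs_nonneg _)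
        ((abs_nonneg _).trans (hC z))

/-- **SOJOURNS IN EQUILIBRIUM**: `P̂(Z_a ∈ T, k rejections after a) = ∫_T (1 − α ∘ fst)^k dπ̂`
for every measurable `T ⊆ Ω × Bool` (`T = S × {accept}`: next). -/
theorem markedRun_prob_eq (hw0 : ∀ x, 0 < w x) (hinv : Kernel.Invariant (indepMH q w) π)
    {T : Set (Ω × Bool)} (hT : MeasurableSet T) (a k : ℕ) :
    (imhRecordPath q w π).real {x | x a ∈ T ∧ ∀ j < k, (x (a + 1 + j)).2 = false}
      = ∫ z in T, (1 - (imhAcceptMass q w z.1).toReal) ^ k ∂(imhRecord q w ∘ₘ π) := by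
  have hE : MeasurableSet {x : ℕ → Ω × Bool | x a ∈ T ∧ ∀ j < k, (x (a + 1 + j)).2 = false} :=
    measurableSet_setOf.2 ((measurableSet_setOf.1 (measurable_pi_apply a hT)).and
      (measurable_rejectRun a k))
  rw [← integral_indicator_one hE, ← integral_indicator hT]
  calc _ = ∫ x, T.indicator 1 (x a) * ∏ j ∈ range k, (1 - acceptFlag (x (a + 1 + j)))
          ∂(imhRecordPath q w π) := by
        refine integral_congr_ae (ae_of_all _ fun x => ?_)
        dsimp only
        rw [prod_one_sub_acceptFlag]
        exact RejectRun.indicator_and T (fun y : ℕ → Ω × Bool => y a) _ x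
    _ = _ := integral_mul_rejectRun hw0 hinv (measurable_one.indicator hT) (C := 1)
          (fun z => by by_cases hz : z ∈ T <;> simp [hz]) a k
    _ = _ := integral_congr_ae (ae_of_all _ fun z => by by_cases hz : z ∈ T <;> simp [hz])

/-- **THE GEOMETRIC LAW OF THE MULTIPLICITIES, path form**: `P̂(Z_a ∈ S × {accept}, k rejections
after a) = ∫_S α (1 − α)^k dπ` — given that the move at time `a` was accepted into state `x`, at
least `k` repetitions of `x` follow with probability `(1 − α(x))^k`; `x` is `α π`-distributed. -/
theorem acceptedRun_prob_eq (hw0 : ∀ x, 0 < w x) (hinv : Kernel.Invariant (indepMH q w) π)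
    {S : Set Ω} (hS : MeasurableSet S) (a k : ℕ) :
    (imhRecordPath q w π).real
        {x | x a ∈ S ×ˢ ({true} : Set Bool) ∧ ∀ j < k, (x (a + 1 + j)).2 = false}
      = ∫ x in S, (imhAcceptMass q w x).toReal * (1 - (imhAcceptMass q w x).toReal) ^ k ∂π := by
  have hw : Measurable w := Fact.out
  obtain ⟨hHm, hHb⟩ : Measurable (fun y => S.indicator (1 : Ω → ℝ) y *
      (1 - (imhAcceptMass q w y).toReal) ^ k) ∧
      ∀ y, |S.indicator (1 : Ω → ℝ) y * (1 - (imhAcceptMass q w y).toReal) ^ k| ≤ 1 * 1 :=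
    ⟨(measurable_one.indicator hS).mul
      ((measurable_const.sub (measurable_toReal_imhAcceptMass hw)).pow_const k), fun y => by
      rw [abs_mul]
      exact mul_le_mul (by by_cases hy : y ∈ S <;> simp [hy])
        (abs_pow_one_sub_toReal_imhAcceptMass_le y k) (abs_nonneg _) zero_le_one⟩
  rw [markedRun_prob_eq hw0 hinv (hS.prod (measurableSet_singleton _)) a k,
    ← integral_indicator (hS.prod (measurableSet_singleton _)), ← integral_indicator hS]
  calc _ = ∫ z, acceptFlag z * (S.indicator (1 : Ω → ℝ) z.1 *
          (1 - (imhAcceptMass q w z.1).toReal) ^ k) ∂(imhRecord q w ∘ₘ π) :=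
        integral_congr_ae (ae_of_all _ fun z => by
          obtain ⟨y, b⟩ := z
          cases b <;> by_cases hy : y ∈ S <;> simp [acceptFlag, hy, Set.mem_prod])
    _ = _ := by
        rw [integral_acceptFlag_mul hw hw0 hinv hHm hHb]
        exact integral_congr_ae (ae_of_all _ fun y => by by_cases hy : y ∈ S <;> simp [hy])

/-- **THE MULTIPLICITY-WEIGHTED ACCEPTED ROWS REPRODUCE `π` EXACTLY**: for every measurable `S`
and time `a`, `Σ_{k ≥ 0} P̂(Z_a ∈ S × {accept}, k rejections after a) = π(S)` (the summand is
`E[A_a 1_S(X_a) 1{𝔫_a > k}]`, `𝔫_a` the multiplicity; pointwise `Σ_k α (1 − α)^k = 1`, `α > 0`). -/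
theorem hasSum_acceptedRun_prob (hw0 : ∀ x, 0 < w x) (hinv : Kernel.Invariant (indepMH q w) π)
    {S : Set Ω} (hS : MeasurableSet S) (a : ℕ) :
    HasSum (fun k => (imhRecordPath q w π).real
        {x | x a ∈ S ×ˢ ({true} : Set Bool) ∧ ∀ j < k, (x (a + 1 + j)).2 = false}) (π.real S) := by
  have hw : Measurable w := Fact.out
  have hαm := measurable_toReal_imhAcceptMass (q := q) hw
  have hα0 : ∀ x, 0 < (imhAcceptMass q w x).toReal := toReal_imhAcceptMass_pos hw hw0
  have hα1 : ∀ x, (imhAcceptMass q w x).toReal ≤ 1 := toReal_imhAcceptMass_le_one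
  have hb0 : ∀ x, 0 ≤ 1 - (imhAcceptMass q w x).toReal := fun x => sub_nonneg.2 (hα1 x)
  have hb1 : ∀ x, 1 - (imhAcceptMass q w x).toReal ≤ 1 := fun x => sub_le_self _ (hα0 x).le
  simp_rw [acceptedRun_prob_eq hw0 hinv hS a]
  refine (hasSum_iff_tendsto_nat_of_nonneg (fun k => setIntegral_nonneg hS fun x _ =>
    mul_nonneg (hα0 x).le (pow_nonneg (hb0 x) _)) _).2 ?_
  have hI : ∀ i : ℕ, Integrable (fun x => (imhAcceptMass q w x).toReal *
      (1 - (imhAcceptMass q w x).toReal) ^ i) (π.restrict S) := fun i =>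
    integrable_of_bounded _ (hαm.mul ((measurable_const.sub hαm).pow_const i)) (C := 1 * 1)
      fun x => by
        rw [abs_mul, abs_of_nonneg (hα0 x).le, abs_of_nonneg (pow_nonneg (hb0 x) _)]
        exact mul_le_mul (hα1 x) (pow_le_one₀ (hb0 x) (hb1 x)) (pow_nonneg (hb0 x) _) zero_le_one
  have hsum : ∀ N : ℕ, ∑ i ∈ range N, ∫ x in S, (imhAcceptMass q w x).toReal *
      (1 - (imhAcceptMass q w x).toReal) ^ i ∂π
        = ∫ x in S, (1 - (1 - (imhAcceptMass q w x).toReal) ^ N) ∂π := fun N => by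
    rw [← integral_finsetSum _ fun i _ => hI i]
    refine integral_congr_ae (ae_of_all _ fun x => ?_)
    dsimp only
    rw [← mul_sum, ← mul_neg_geom_sum, sub_sub_cancel]
  simp_rw [hsum]
  rw [show π.real S = ∫ _ in S, (1 : ℝ) ∂π by rw [setIntegral_const, smul_eq_mul, mul_one]]
  refine tendsto_integral_of_dominated_convergence (fun _ => (1 : ℝ))
    (fun N => (measurable_const.sub ((measurable_const.sub hαm).pow_const N)).aestronglyMeasurable)
    (integrable_const _) (fun N => ae_of_all _ fun x => ?_) (ae_of_all _ fun x => ?_)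
  · rw [Real.norm_eq_abs, abs_of_nonneg (sub_nonneg.2 (pow_le_one₀ (hb0 x) (hb1 x)))]
    exact sub_le_self _ (pow_nonneg (hb0 x) _)
  · have h := (tendsto_pow_atTop_nhds_zero_of_lt_one (hb0 x) (sub_lt_self _ (hα0 x))).const_sub 1
    simpa using h

end Path

/-! ### §4 The lattice instance -/

section Lattice

open Literature.MathematicalPhysics.QuantumFieldTheory
open Literature.MathematicalPhysics.QuantumFieldTheory.Luscher2010
open Summit.Ventures.LatticeQCDFlow.TrivializingMaps
open scoped Matrix Matrix.Norms.Frobenius ContDiff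

variable {d L n : ℕ} [NeZero L]

/-- **THE SOJOURN LAW OF AN EXACT FLOW SAMPLER ON `SU(n)^E` — UNCONDITIONAL, every volume.**
Smooth action `S`, approximately trivializing flow `Φ` (smooth generator `F`, Lüscher defect
`|L_t(F_t) − S − c t| ≤ δ` on `[0, 1]`), model `q = (Φ 1)_* D[V]`, `π` = Boltzmann: a measurable
weight `w` with `w · q = π`, `π K = π`, `α ≥ e^{−2δ}`, and for the equilibrium record chain `P̂`:
(i) after ANY history event at any time `a`, `k` rejections follow with conditional probability
`≤ (1 − e^{−2δ})^k` (any start: `rejectRun_prob_le_of_floor`); (ii) for every measurable `T` and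
time `a`, `Σ_k P̂(Z_a ∈ T × {accept}, k rejections after a) = π(T)` — the multiplicity-weighted
accepted configurations are exactly Boltzmann-distributed.  (`Fact (Measurable w)` := `⟨hw⟩`.) -/
theorem flowSampler_sojourn_law (B : SuBasis n)
    {S : AmbConfig d L n → ℝ} (hS : ContDiff ℝ ∞ S) {F : ℝ → AmbConfig d L n → ℝ}
    (hF : ContDiff ℝ ∞ fun p : ℝ × AmbConfig d L n => F p.1 p.2)
    {Φ} (hΦ : IsFlowMap (fun t W => -linkGrad B (F t) W) Φ) {c : ℝ → ℝ} {δ : ℝ}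
    (hδ : ∀ t ∈ Set.Icc (0 : ℝ) 1, ∀ U : GaugeConfig d L (Matrix.specialUnitaryGroup (Fin n) ℂ),
      |luscherL B S t (F t) (WilsonFlow.coeConfig U) - S (WilsonFlow.coeConfig U) - c t| ≤ δ)
    (q : Measure (GaugeConfig d L (Matrix.specialUnitaryGroup (Fin n) ℂ))) [IsProbabilityMeasure q]
    (hq : q = Measure.map (Φ 1) (trivialMeasure (Matrix.specialUnitaryGroup (Fin n) ℂ) d L))
    {π : Measure (GaugeConfig d L (Matrix.specialUnitaryGroup (Fin n) ℂ))} [IsProbabilityMeasure π]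
    (hπB : π = boltzmannMeasure fun U => S (WilsonFlow.coeConfig U)) :
    ∃ w : GaugeConfig d L (Matrix.specialUnitaryGroup (Fin n) ℂ) → ℝ, Measurable w ∧
      (q.withDensity fun U => ENNReal.ofReal (w U)) = π ∧ Kernel.Invariant (indepMH q w) π ∧
      (∀ U, Real.exp (-(2 * δ)) ≤ (imhAcceptMass q w U).toReal) ∧
      ∀ [Fact (Measurable w)],
        (∀ (a k : ℕ) (H : Set ((i : ↥(Finset.Iic a)) →
            GaugeConfig d L (Matrix.specialUnitaryGroup (Fin n) ℂ) × Bool)), MeasurableSet H →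
          (imhRecordPath q w π).real {x | frestrictLe a x ∈ H ∧ ∀ j < k, (x (a + 1 + j)).2 = false}
            ≤ (1 - Real.exp (-(2 * δ))) ^ k * (imhRecordPath q w π).real (frestrictLe a ⁻¹' H)) ∧
        ∀ (T : Set (GaugeConfig d L (Matrix.specialUnitaryGroup (Fin n) ℂ))), MeasurableSet T →
          ∀ a : ℕ, HasSum (fun k => (imhRecordPath q w π).real
            {x | x a ∈ T ×ˢ ({true} : Set Bool) ∧ ∀ j < k, (x (a + 1 + j)).2 = false})
            (π.real T) := by
  subst hπB
  obtain ⟨w, hw, hlo, -, hπ, hinv, hacc, -⟩ := flowSampler_exact_doeblin B hS hF hΦ hδ q hq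
  have hw0 : ∀ U, 0 < w U := fun U => (Real.exp_pos _).trans_le (hlo U)
  have hfl : ∀ U, Real.exp (-(2 * δ)) ≤ (imhAcceptMass q w U).toReal := fun U => by
    have h := ENNReal.toReal_mono
      (ne_top_of_le_ne_top ENNReal.one_ne_top (imhAcceptMass_le_one q w U)) (hacc U)
    rwa [ENNReal.toReal_ofReal (Real.exp_pos _).le] at h
  refine ⟨w, hw, hπ, hinv, hfl, ?_⟩
  intro hFw
  exact ⟨fun a k H hH => rejectRun_prob_le_of_floor hw0 _ hfl a k hH,
    fun T hT a => hasSum_acceptedRun_prob hw0 hinv hT a⟩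

end Lattice

end Summit.Ventures.LatticeQCDFlow.Scoring
end
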